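import Mathlib.Combinatorics.SetFamily.Compression.Down
import Mathlib.Tactic
import HarnessLib
import HarnessLib.Audit.Tags
import Summits.CriticalPhenomena.PercolationContinuityZ3.Theorems.PercNearOneGluingNoHeavyLowerTailSahiRainbowTwoColour

/-!
# The two-colouring statement ≡ the three-family twin inequality (M3♯)

Support file (seat `prim-masterthm-p1`, gen 41; `--supports stmt-CriticalPhenomena-4575`).  No `sorry`, standard axioms.
Companion of `…SahiRainbowTwoColour` (definitions `pairMeets`, `monoMeets`, typed `TwoColourMeets`).  Memo
`run/shared/lean/prim/prim-masterthm/FROM-prim-masterthm-p1-g41-TWO-COLOUR.md`.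

* `threeFamilyTwin_of_twoColourMeets` — given the two-colouring statement, gen 40's `ThreeFamilyTwin` follows: take
  `X = Q ∪ V₁`, `Y = σQ ∪ V₀`; then `X ⊔ Y` is complement-closed with `#(X ∪ Y) = 2(#Q + #U₀ + #U₁)` and `monoMeets X Y` is
  LITERALLY the colour set of `ThreeFamilyTwin` (meets of `σQ ∪ V₀` = complemented joins of `Q ∪ V₀`, `pairMeets_image_sdiff`).
* `twoColourMeets_of_threeFamilyTwin` — conversely, split `X` into `Q` (members whose complement is in `Y`) and `V₁` (complement in
  `X`), `Y` into `σQ` and `V₀`, and halve the complement-closed `V₀, V₁` (`exists_half_of_closed`); `ThreeFamilyTwin` applies.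
* `rainbowMeetCojoin_of_threeFamilyTwin` — hence M3♯ alone implies the rainbow lemma (through `rainbowMeetCojoin_of_twoColourMeets`).
HONEST FRAMING: all three statements remain OPEN; these are equivalences/implications only. [this work]
-/

namespace Summit.CriticalPhenomena.PercolationContinuityZ3.Theorems.SahiColouredDaykin

open Finset
open scoped FinsetFamily

variable {α : Type*} [DecidableEq α]

/-! ### Equivalence with the three-family twin inequality -/

section Equivalence

variable {G : Finset α}

/-- **`TwoColourMeets ⟹ ThreeFamilyTwin`.**  Take `X = Q ∪ V₁`, `Y = σQ ∪ V₀`. [this work] -/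
theorem threeFamilyTwin_of_twoColourMeets (h : TwoColourMeets α) : ThreeFamilyTwin α := by
  intro G Q U₀ U₁ hG hQ hU₀ hU₁ hQV₀ hQV₁ hV₀V₁ h3
  -- notation
  set V₀ := U₀ ∪ U₀.image (G \ ·) with hV₀def
  set V₁ := U₁ ∪ U₁.image (G \ ·) with hV₁def
  set σQ := Q.image fun q => G \ q with hσQ
  have hQG : ∀ q ∈ Q, q ⊆ G := fun q hq => hG q (by simp [hq])
  have hU₀G : ∀ u ∈ U₀, u ⊆ G := fun u hu => hG u (by simp [hu])
  have hU₁G : ∀ u ∈ U₁, u ⊆ G := fun u hu => hG u (by simp [hu])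
  have hV₀G : ∀ v ∈ V₀, v ⊆ G := fun v hv => subset_of_mem_union_image hU₀G hv
  have hV₁G : ∀ v ∈ V₁, v ⊆ G := fun v hv => subset_of_mem_union_image hU₁G hv
  have hV₀c : ∀ v ∈ V₀, G \ v ∈ V₀ := fun v hv => sdiff_mem_union_image hU₀G hv
  have hV₁c : ∀ v ∈ V₁, G \ v ∈ V₁ := fun v hv => sdiff_mem_union_image hU₁G hv
  set X := Q ∪ V₁ with hX
  set Y := σQ ∪ V₀ with hY
  -- hypotheses of `TwoColourMeets`
  have hXYG : ∀ z ∈ X ∪ Y, z ⊆ G := by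
    intro z hz
    rcases mem_union.1 hz with hz | hz
    · rcases mem_union.1 hz with hz | hz
      · exact hQG z hz
      · exact hV₁G z hz
    · rcases mem_union.1 hz with hz | hz
      · obtain ⟨q, _, rfl⟩ := mem_image.1 hz; exact sdiff_subset
      · exact hV₀G z hz
  have hcc : ∀ z ∈ X ∪ Y, G \ z ∈ X ∪ Y := by
    intro z hz
    rcases mem_union.1 hz with hz | hz
    · rcases mem_union.1 hz with hz | hz
      · exact mem_union.2 (Or.inr (mem_union.2 (Or.inl (mem_image.2 ⟨z, hz, rfl⟩))))
      · exact mem_union.2 (Or.inl (mem_union.2 (Or.inr (hV₁c z hz))))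
    · rcases mem_union.1 hz with hz | hz
      · obtain ⟨q, hq, rfl⟩ := mem_image.1 hz
        rw [Finset.sdiff_sdiff_eq_self (hQG q hq)]
        exact mem_union.2 (Or.inl (mem_union.2 (Or.inl hq)))
      · exact mem_union.2 (Or.inr (mem_union.2 (Or.inr (hV₀c z hz))))
  have hQσQ : Disjoint Q σQ := by
    rw [disjoint_left]; intro z hz hz'
    obtain ⟨q, hq, rfl⟩ := mem_image.1 hz'
    exact hQ q hq hz
  have hV₁σQ : Disjoint V₁ σQ := by
    rw [disjoint_left]; intro z hz hz'
    obtain ⟨q, hq, rfl⟩ := mem_image.1 hz'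
    have : q ∈ V₁ := by
      have := hV₁c _ hz; rwa [Finset.sdiff_sdiff_eq_self (hQG q hq)] at this
    exact disjoint_left.1 hQV₁ hq this
  have hXY : Disjoint X Y :=
    disjoint_union_left.2 ⟨disjoint_union_right.2 ⟨hQσQ, hQV₀⟩, disjoint_union_right.2 ⟨hV₁σQ, hV₀V₁.symm⟩⟩
  -- cardinalities
  have cσQ : #σQ = #Q := by
    apply card_image_of_injOn
    intro a ha b hb hab
    have := congrArg (fun s => G \ s) hab
    simpa only [Finset.sdiff_sdiff_eq_self (hQG a ha), Finset.sdiff_sdiff_eq_self (hQG b hb)] using this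
  have cV₀ : #V₀ = 2 * #U₀ := card_union_image_sdiff hU₀G hU₀
  have cV₁ : #V₁ = 2 * #U₁ := card_union_image_sdiff hU₁G hU₁
  have cX : #X = #Q + #V₁ := card_union_of_disjoint hQV₁
  have cY : #Y = #σQ + #V₀ := by
    rw [hY, card_union_of_disjoint]
    rw [disjoint_left]; intro z hz hz'
    exact disjoint_left.1 hV₁σQ (by
      obtain ⟨q, hq, rfl⟩ := mem_image.1 hz
      exact absurd (disjoint_left.1 hQV₀ hq (by
        have := hV₀c _ hz'; rwa [Finset.sdiff_sdiff_eq_self (hQG q hq)] at this)) (fun h => h)) hz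
  have cZ : #(X ∪ Y) = 2 * (#Q + #U₀ + #U₁) := by
    rw [card_union_of_disjoint hXY, cX, cY, cσQ, cV₀, cV₁]; ring
  have h6 : 6 ≤ #(X ∪ Y) := by rw [cZ]; omega
  have main := h G X Y hXYG hcc hXY h6
  -- identify the colour set
  have hYimg : Y = (Q ∪ V₀).image fun q => G \ q := by
    rw [hY, image_union, image_sdiff_eq_self_of_closed hV₀G hV₀c]
  have hQV₀G : ∀ z ∈ Q ∪ V₀, z ⊆ G := by
    intro z hz; rcases mem_union.1 hz with hz | hz
    · exact hQG z hz
    · exact hV₀G z hz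
  have hmono : monoMeets X Y =
      insert ∅ (((Q ∪ (U₁ ∪ U₁.image (G \ ·))).offDiag.image fun p => p.1 ∩ p.2) ∪
        ((Q ∪ (U₀ ∪ U₀.image (G \ ·))).offDiag.image fun p => G \ (p.1 ∪ p.2))) := by
    unfold monoMeets
    rw [hYimg, pairMeets_image_sdiff hQV₀G]
    rfl
  rw [← hmono]
  omega

/-- **Halving a complement-closed family**: a family `V ⊆ 2^G` (`G ≠ ∅`) closed under complement in `G` is `U ⊔ σU` for a
complement-free `U ⊆ V`. [this work] -/
theorem exists_half_of_closed (hGne : G.Nonempty) :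
    ∀ (V : Finset (Finset α)), (∀ v ∈ V, v ⊆ G) → (∀ v ∈ V, G \ v ∈ V) →
      ∃ U : Finset (Finset α), U ⊆ V ∧ (∀ u ∈ U, G \ u ∉ U) ∧ V = U ∪ U.image fun u => G \ u := by
  intro V
  induction' hn : #V using Nat.strong_induction_on with n ih generalizing V
  intro hVG hVc
  by_cases hV : V = ∅
  · refine ⟨∅, empty_subset _, by simp, ?_⟩; rw [hV]; simp
  obtain ⟨v, hv⟩ := nonempty_iff_ne_empty.2 hV
  have hvne : G \ v ≠ v := by
    intro h
    have h1 : v = ∅ := by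
      apply eq_empty_of_forall_notMem
      intro t ht
      have ht' := ht
      rw [← h] at ht'
      exact (mem_sdiff.1 ht').2 ht
    apply hGne.ne_empty
    have : G \ v = ∅ := by rw [h, h1]
    rwa [h1, sdiff_empty] at this
  set V' := (V.erase v).erase (G \ v) with hV'
  have hV'sub : V' ⊆ V := (erase_subset _ _).trans (erase_subset _ _)
  have hV'G : ∀ w ∈ V', w ⊆ G := fun w hw => hVG w (hV'sub hw)
  have hV'c : ∀ w ∈ V', G \ w ∈ V' := by
    intro w hw
    have hw1 : w ≠ G \ v := (mem_erase.1 hw).1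
    have hw2 : w ≠ v := (mem_erase.1 (mem_erase.1 hw).2).1
    have hwV : w ∈ V := hV'sub hw
    refine mem_erase.2 ⟨?_, mem_erase.2 ⟨?_, hVc w hwV⟩⟩
    · intro h
      apply hw2
      have := congrArg (fun s => G \ s) h
      simpa only [Finset.sdiff_sdiff_eq_self (hVG w hwV), Finset.sdiff_sdiff_eq_self (hVG v hv)] using this
    · intro h; apply hw1; rw [← h, Finset.sdiff_sdiff_eq_self (hVG w hwV)]
  have hlt : #V' < n := by
    rw [← hn]
    exact lt_of_le_of_lt (card_erase_le) (card_erase_lt_of_mem hv)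
  obtain ⟨U', hU'V', hU'cf, hV'eq⟩ := ih #V' hlt V' rfl hV'G hV'c
  refine ⟨insert v U', ?_, ?_, ?_⟩
  · exact insert_subset hv (hU'V'.trans hV'sub)
  · intro u hu
    rcases mem_insert.1 hu with rfl | hu
    · rw [mem_insert, not_or]
      exact ⟨hvne, fun h => (mem_erase.1 (hU'V' h)).1 rfl⟩
    · rw [mem_insert, not_or]
      refine ⟨fun h => ?_, hU'cf u hu⟩
      have hu' := hU'V' hu
      have : u = G \ v := by rw [← h, Finset.sdiff_sdiff_eq_self (hV'G u hu')]
      exact (mem_erase.1 hu').1 this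
  · ext w
    simp only [mem_union, mem_insert, mem_image, exists_eq_or_imp]
    constructor
    · intro hw
      by_cases h1 : w = v
      · exact Or.inl (Or.inl h1)
      by_cases h2 : w = G \ v
      · exact Or.inr (Or.inl h2.symm)
      have hwV' : w ∈ V' := mem_erase.2 ⟨h2, mem_erase.2 ⟨h1, hw⟩⟩
      rw [hV'eq] at hwV'
      rcases mem_union.1 hwV' with h | h
      · exact Or.inl (Or.inr h)
      · obtain ⟨u, hu, rfl⟩ := mem_image.1 h
        exact Or.inr (Or.inr ⟨u, hu, rfl⟩)
    · rintro ((rfl | hw) | (hw | ⟨u, hu, rfl⟩))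
      · exact hv
      · exact hV'sub (hV'eq ▸ mem_union.2 (Or.inl hw))
      · rw [← hw]; exact hVc v hv
      · exact hV'sub (hV'eq ▸ mem_union.2 (Or.inr (mem_image.2 ⟨u, hu, rfl⟩)))

/-- **`ThreeFamilyTwin ⟹ TwoColourMeets`.**  Split `X` into `Q` (complement in `Y`) and `V₁` (complement in `X`), `Y` into
`σQ` and `V₀`, halve `V₀, V₁`. [this work] -/
theorem twoColourMeets_of_threeFamilyTwin (h : ThreeFamilyTwin α) : TwoColourMeets α := by
  intro G X Y hZG hcc hXY h6
  -- `G` is nonempty (a family of subsets of `∅` has at most one member)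
  have hGne : G.Nonempty := by
    rw [nonempty_iff_ne_empty]; rintro rfl
    have : #(X ∪ Y) ≤ 1 := by
      apply card_le_one.2
      intro a ha b hb
      rw [subset_empty.1 (hZG a ha), subset_empty.1 (hZG b hb)]
    omega
  have hXG : ∀ x ∈ X, x ⊆ G := fun x hx => hZG x (mem_union_left _ hx)
  have hYG : ∀ y ∈ Y, y ⊆ G := fun y hy => hZG y (mem_union_right _ hy)
  -- the three parts
  set Q := X.filter fun x => G \ x ∈ Y with hQ
  set V₁ := X.filter fun x => G \ x ∈ X with hV₁
  set V₀ := Y.filter fun y => G \ y ∈ Y with hV₀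
  have hQG : ∀ q ∈ Q, q ⊆ G := fun q hq => hXG q (mem_filter.1 hq).1
  have hV₁G : ∀ v ∈ V₁, v ⊆ G := fun v hv => hXG v (mem_filter.1 hv).1
  have hV₀G : ∀ v ∈ V₀, v ⊆ G := fun v hv => hYG v (mem_filter.1 hv).1
  have hV₁c : ∀ v ∈ V₁, G \ v ∈ V₁ := by
    intro v hv
    obtain ⟨hvX, hv'⟩ := mem_filter.1 hv
    exact mem_filter.2 ⟨hv', by rw [Finset.sdiff_sdiff_eq_self (hXG v hvX)]; exact hvX⟩
  have hV₀c : ∀ v ∈ V₀, G \ v ∈ V₀ := by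
    intro v hv
    obtain ⟨hvY, hv'⟩ := mem_filter.1 hv
    exact mem_filter.2 ⟨hv', by rw [Finset.sdiff_sdiff_eq_self (hYG v hvY)]; exact hvY⟩
  have hXeq : X = Q ∪ V₁ := by
    ext x
    simp only [hQ, hV₁, mem_union, mem_filter]
    constructor
    · intro hx
      rcases mem_union.1 (hcc x (mem_union_left _ hx)) with h' | h'
      · exact Or.inr ⟨hx, h'⟩
      · exact Or.inl ⟨hx, h'⟩
    · rintro (⟨hx, _⟩ | ⟨hx, _⟩) <;> exact hx
  have hYeq : Y = (Q.image fun q => G \ q) ∪ V₀ := by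
    ext y
    simp only [hQ, hV₀, mem_union, mem_filter, mem_image]
    constructor
    · intro hy
      rcases mem_union.1 (hcc y (mem_union_right _ hy)) with h' | h'
      · refine Or.inl ⟨G \ y, ⟨h', ?_⟩, Finset.sdiff_sdiff_eq_self (hYG y hy)⟩
        rw [Finset.sdiff_sdiff_eq_self (hYG y hy)]; exact hy
      · exact Or.inr ⟨hy, h'⟩
    · rintro (⟨q, ⟨_, hq'⟩, rfl⟩ | ⟨hy, _⟩)
      · exact hq'
      · exact hy
  -- halve `V₀`, `V₁`
  obtain ⟨U₀, hU₀V₀, hU₀cf, hV₀eq⟩ := exists_half_of_closed hGne V₀ hV₀G hV₀c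
  obtain ⟨U₁, hU₁V₁, hU₁cf, hV₁eq⟩ := exists_half_of_closed hGne V₁ hV₁G hV₁c
  have hU₀G : ∀ u ∈ U₀, u ⊆ G := fun u hu => hV₀G u (hU₀V₀ hu)
  have hU₁G : ∀ u ∈ U₁, u ⊆ G := fun u hu => hV₁G u (hU₁V₁ hu)
  -- hypotheses of `ThreeFamilyTwin`
  have hQcf : ∀ q ∈ Q, G \ q ∉ Q := by
    intro q hq h'
    have h1 : G \ q ∈ Y := (mem_filter.1 hq).2
    have h2 : G \ q ∈ X := (mem_filter.1 h').1
    exact disjoint_left.1 hXY h2 h1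
  have hall : ∀ x ∈ Q ∪ U₀ ∪ U₁, x ⊆ G := by
    intro x hx
    rcases mem_union.1 hx with hx | hx
    · rcases mem_union.1 hx with hx | hx
      · exact hQG x hx
      · exact hU₀G x hx
    · exact hU₁G x hx
  have hQV₀' : Disjoint Q (U₀ ∪ U₀.image (G \ ·)) := by
    rw [← hV₀eq, disjoint_left]
    intro q hq hq'
    exact disjoint_left.1 hXY (mem_filter.1 hq).1 (mem_filter.1 hq').1
  have hQV₁' : Disjoint Q (U₁ ∪ U₁.image (G \ ·)) := by
    rw [← hV₁eq, disjoint_left]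
    intro q hq hq'
    exact disjoint_left.1 hXY (mem_filter.1 hq').2 (mem_filter.1 hq).2
  have hV₀V₁' : Disjoint (U₀ ∪ U₀.image (G \ ·)) (U₁ ∪ U₁.image (G \ ·)) := by
    rw [← hV₀eq, ← hV₁eq, disjoint_left]
    intro v hv hv'
    exact disjoint_left.1 hXY (mem_filter.1 hv').1 (mem_filter.1 hv).1
  -- cardinalities
  have cV₀ : #V₀ = 2 * #U₀ := by rw [hV₀eq]; exact card_union_image_sdiff hU₀G hU₀cf
  have cV₁ : #V₁ = 2 * #U₁ := by rw [hV₁eq]; exact card_union_image_sdiff hU₁G hU₁cf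
  have cσQ : #(Q.image fun q => G \ q) = #Q := by
    apply card_image_of_injOn
    intro a ha b hb hab
    have := congrArg (fun s => G \ s) hab
    simpa only [Finset.sdiff_sdiff_eq_self (hQG a ha), Finset.sdiff_sdiff_eq_self (hQG b hb)] using this
  have hQV₁ : Disjoint Q V₁ := by rw [hV₁eq]; exact hQV₁'
  have cX : #X = #Q + #V₁ := by rw [hXeq]; exact card_union_of_disjoint hQV₁
  have hσQV₀ : Disjoint (Q.image fun q => G \ q) V₀ := by
    rw [disjoint_left]; intro z hz hz'
    obtain ⟨q, hq, rfl⟩ := mem_image.1 hz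
    have : q ∈ V₀ := by
      have := hV₀c _ hz'; rwa [Finset.sdiff_sdiff_eq_self (hQG q hq)] at this
    exact disjoint_left.1 hXY (mem_filter.1 hq).1 (mem_filter.1 this).1
  have cY : #Y = #Q + #V₀ := by rw [hYeq, card_union_of_disjoint hσQV₀, cσQ]
  have cZ : #(X ∪ Y) = 2 * (#Q + #U₀ + #U₁) := by
    rw [card_union_of_disjoint hXY, cX, cY, cV₀, cV₁]; ring
  have h3 : 3 ≤ #Q + #U₀ + #U₁ := by omega
  have main := h G Q U₀ U₁ hall hQcf hU₀cf hU₁cf hQV₀' hQV₁' hV₀V₁' h3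
  -- identify the colour set
  have hQV₀G : ∀ z ∈ Q ∪ V₀, z ⊆ G := by
    intro z hz; rcases mem_union.1 hz with hz | hz
    · exact hQG z hz
    · exact hV₀G z hz
  have hYimg : Y = (Q ∪ V₀).image fun q => G \ q := by
    rw [hYeq, image_union, image_sdiff_eq_self_of_closed hV₀G hV₀c]
  have hmono : monoMeets X Y =
      insert ∅ (((Q ∪ (U₁ ∪ U₁.image (G \ ·))).offDiag.image fun p => p.1 ∩ p.2) ∪
        ((Q ∪ (U₀ ∪ U₀.image (G \ ·))).offDiag.image fun p => G \ (p.1 ∪ p.2))) := by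
    unfold monoMeets
    rw [hYimg, pairMeets_image_sdiff hQV₀G, ← hV₀eq, ← hV₁eq, ← hXeq]
    rfl
  rw [hmono, cZ]
  omega

end Equivalence

/-- Consequently `TwoColourMeets` also gives the face `U₀ = U₁ = ∅` of `ThreeFamilyTwin` through the rainbow lemma, and the
whole chain `RainbowMeetCojoin ⟸ ThreeFamilyTwin ⟸ TwoColourMeets ⟸ ThreeFamilyTwin`. [this work] -/
theorem rainbowMeetCojoin_of_threeFamilyTwin (h : ThreeFamilyTwin α) : RainbowMeetCojoin α :=
  rainbowMeetCojoin_of_twoColourMeets (twoColourMeets_of_threeFamilyTwin h)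


end Summit.CriticalPhenomena.PercolationContinuityZ3.Theorems.SahiColouredDaykin
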